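import Summits.HodgeConjecture.HodgeConjecture.Theorems.Ring2HabitatWeilComponentsRefereedFourfolds
import Literature.AlgebraicGeometry.HodgeTheory.WeilClassesProductsOfFactors
import HarnessLib

/-!
# Ring 2 · AbelianAll (seat `ab-weil-2`, gen 8) — CUSP ANCHORS FROM REFEREED PRINT: surface × fourfold SIXFOLDS and
  fourfold × fourfold EIGHTFOLDS of `K = ℚ(√-3)` / `ℚ(i)` of ARBITRARY discriminants, and everything `K`-isogenous to them,
  have algebraic Weil classes — modulo ONE refereed split-sixfold fact (Schoen 1998 / Koike 2004)

HONEST FRAMING (sub-cell `pub-hodge-ring2-ab-*`, verbatim): research route, not a corollary; conditional on HC_CM plus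
one named minimal statement. (Cell `pub-hodge-ring2`, verbatim: research route conditional on HC_CM; not a corollary;
Q11.4-sentence-2 already refuted in dim ≥ 3.) `HC_CM` does not occur in this file. No definition, no named fact, no
`sorry`; the printed theorems enter as BINDERS (`hS3 : Schoen1998_weilClasses_algebraic_hyperbolicSixfold_three`,
`hK : Koike2004_weilClasses_algebraic_hyperbolicSixfold_one`) or through the fact-free ladder statement
`WeilAlgebraicAll 2 d` ("every Weil-type FOURFOLD of `ℚ(√-d)`, every discriminant").

WHY (the seat's census, `pub-hodge-ring2-ab-weil-2/CENSUS-PRINT-G8.md` §5–§7). Of the 133 Picard–Lefschetz-invisible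
Weil-type `k = 4` Hecke–Prym families of ab-weil-1's census exactly 68 are OPEN in print at cell AND family level
(16 non-split non-simple `(3,3)` families of `ℚ(√-3)`, 28 + 24 non-simple `(4,4)` families of `ℚ(√-3)` / `ℚ(i)`), and
EVERY ONE of the 68 has a cusp whose fibre (a genuine fibre of the completed abelian scheme, ab-weil-1 THEOREM A) is
`K`-isogenous to `S × X` (a `(1,1)` `K`-surface times a `(2,2)` `K`-fourfold; all 16 sixfold rows) or to `X × Y` (two
`(2,2)` `K`-fourfolds; all 52 eightfold rows). Gen 7 anchored these cusps by a block-by-block invariant-theory argument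
in markdown (THEOREM G7-A, LEMMA S, LEMMA Q). This file replaces that, for these cusp types, by KERNEL theorems modulo
ONE REFEREED fact: for `K ∈ {ℚ(√-3), ℚ(i)}` the Weil classes of EVERY Weil-type fourfold are algebraic whatever its
discriminant (Schoen, Compositio 114 (1998), Theorem p. 329; Koike 2004 Rem. 2.1 — in the tree
`Ring2.Habitat.weilAlgebraicAll_two_of_floorSlice` / `…_of_refereed_one_or_three`, kernel-derived from the split-SIXFOLD
facts by Schoen's §10 transfer, itself a tree theorem), the Weil plane of a `(1,1)` surface is Lefschetz
(`weilClassesOf_le_algebraicClasses_surface`), Weil planes MULTIPLY (`weilClassesOf_prod_le_algebraicClasses`, Schoen 1998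
§10 read downward, a tree theorem on the real carriers) and the product locus is closed under `K`-equivariant isogeny
(`mem_algebraicClasses_of_isogeny_prod`). NO discriminant / splitness hypothesis appears: the cusp fibres of the open
rows are NON-split products (16 + 16 rows) as well as split ones, and the block shapes of the fourfold pieces (gen 7:
`sl2`, `cmE`, `u2`, the rigid `ℚ(i)` block `W₄`) are irrelevant. The literature companion
`WeilClassesProductsOfFactorsFacts` has the same compositions for Markman's all-discriminant fourfold statement F1
(UNREFEREED, every `d`) and for Markman 2023 (refereed, SPLIT fourfolds only); the refereed all-discriminant slice
`d ∈ {1, 3}` is the content added here.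

WHAT IS PROVED. §0 on-path: `WeilAlgebraicAll n d` is a case of the summit. §1 (any `d ≥ 1`, granted
`WeilAlgebraicAll 2 d`): the Weil planes of `S × X`, `X × S` (degree 6) and `X × Y` (degree 8) are algebraic for balanced
`S` (`(1,1)`), `X`, `Y` (`(2,2)`). §2 the refereed instances `d = 3` (`hS3` alone) and `d = 1` (`hK` alone). §3 the
`K`-ISOGENOUS members: every rational `(3,3)` resp. `(4,4)` Weil class of a sixfold resp. eightfold carrying an isogeny
pair towards such a product is algebraic (`d = 3`, `d = 1`, and granted `WeilAlgebraicAll 2 d`). NOT CLAIMED: anything about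
a general member of a Weil component (these loci are `5`- resp. `8`-dimensional in `9`- resp. `16`-dimensional moduli);
anything for `K ∉ {ℚ(√-3), ℚ(i)}` beyond the `WeilAlgebraicAll 2 d`-conditional form; any statement about the 68 families'
generic fibres (their only missing input remains ONE instance of `Ring2.Hypotheses.AbelianSchemeVHC` each, ab-weil-1
Cor G20-E Cor. B).

## References

* [Schoen1998HodgeWeilAddendum] C. Schoen, Addendum to: Hodge classes on self-products of a variety with an automorphism,
  Compositio Math. 114 (1998) 329–336, Theorem (p. 329), §10 (Proposition), §§11–13.
* [Koike2004WeilHodge] K. Koike, Algebraicity of some Weil Hodge classes, Canad. Math. Bull. 47 (2004), Thm. 2.1, Cor. 2.1,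
  Remark 2.1.
* [vanGeemen1994HodgeAV] B. van Geemen, An introduction to the Hodge conjecture for abelian varieties, LNM 1594 (1994),
  4.9–4.10, Lemma 5.2, Thm. 6.12.
* [Markman2025SurveySecant] E. Markman, arXiv:2509.23403, §11.5 Steps 1–2 (the product / isogeny bookkeeping).
* [Deligne2000] P. Deligne, The Hodge conjecture (Clay problem description), §1.
-/

set_option linter.dupNamespace false

noncomputable section

open CategoryTheory

namespace Summit.HodgeConjecture.HodgeConjecture.Ring2.AbelianAll

open Literature.AlgebraicGeometry Literature.AlgebraicGeometry.Motives
open Literature.AlgebraicGeometry.HodgeTheory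
open Literature.AlgebraicTopology.SingularHomology
open Summit.HodgeConjecture.HodgeConjecture.Ring2.Habitat
open Summit.HodgeConjecture.HodgeConjecture.Cruxes.HodgeAbelianVarieties.EStepSecantInduction

variable {S X Y : AbelianVariety ℂ}

/-! ## §0 On path: `WeilAlgebraicAll` is a case of the summit -/

/-- ON-PATH. The Hodge conjecture (for all smooth projective complex varieties) gives `WeilAlgebraicAll n d` for every
`n, d`: the statements of this file are CASES of the summit, nothing stronger. [cite: Deligne2000, §1] -/
theorem weilAlgebraicAll_of_hodgeConjecture_onPath (h : _root_.HodgeConjecture) (n d : ℕ) : WeilAlgebraicAll n d :=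
  fun _ _ hA _ c _ hc hnn ↦ (h (isSmoothProjective_of_dim_eq' hA)).2 n c hc hnn

/-! ## §1 Product sixfolds and eightfolds, granted `WeilAlgebraicAll 2 d` (any `d ≥ 1`) -/

/-- **The Weil plane of a balanced `(2,2)` fourfold is algebraic, granted `WeilAlgebraicAll 2 d`** (pointwise rational
algebraicity ⟹ the complexified plane `E₊ ⊔ E₋ ⊆ N²`, by `weilClassesOf_le_algebraicClasses_of_forall_isRationalClass`).
[cite: vanGeemen1994HodgeAV, Lemma 5.2 and Thm. 6.12] -/
theorem weilClassesOf_fourfold_le_of_weilAlgebraicAll {d : ℕ} (hd : 0 < d) (W : WeilAlgebraicAll 2 d)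
    (hX : X.dim = 2 * 2) {φ : X ⟶ X} (hφ : φ ≫ φ = -(d • 𝟙 X))
    (hXbal : Module.finrank ℂ ↥(Module.End.eigenspace (complexBetti.map φ.hom.hom.hom 1).hom
          (Complex.I * (Real.sqrt d : ℂ)) ⊓
        hodgeOneZero (Motives.isSmoothProjective_of_dim_eq' hX)) = 2) :
    weilClassesOf X φ 2 d ≤ algebraicClasses X.X 2 :=
  weilClassesOf_le_algebraicClasses_of_forall_isRationalClass two_pos hX hd hφ hXbal
    fun c hc hnn hw ↦ W X φ hX hφ c hw hc hnn

/-- **Surface × fourfold SIXFOLDS, any discriminants, granted `WeilAlgebraicAll 2 d`.** For `d ≥ 1`, a `(1,1)` surface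
`(S, ψ)` and a balanced `(2,2)` fourfold `(X, φ)` with `ψ² = φ² = -d`: the Weil plane of `S × X` (diagonal `K`, degree
`6`) consists of algebraic classes. No splitness hypothesis on `S`, `X` or the product.
[cite: Schoen1998HodgeWeilAddendum, §10] [cite: vanGeemen1994HodgeAV, 4.9] -/
theorem weilClassesOf_surface_prod_fourfold_le_of_weilAlgebraicAll {d : ℕ} (hd : 0 < d) (W : WeilAlgebraicAll 2 d)
    (hS : S.dim = 2 * 1) (hX : X.dim = 2 * 2) {ψ : S ⟶ S} {φ : X ⟶ X}
    (hψ : ψ ≫ ψ = -(d • 𝟙 S)) (hφ : φ ≫ φ = -(d • 𝟙 X))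
    (hSbal : Module.finrank ℂ ↥(Module.End.eigenspace (complexBetti.map ψ.hom.hom.hom 1).hom
          (Complex.I * (Real.sqrt d : ℂ)) ⊓
        hodgeOneZero (Motives.isSmoothProjective_of_dim_eq' hS)) = 1)
    (hXbal : Module.finrank ℂ ↥(Module.End.eigenspace (complexBetti.map φ.hom.hom.hom 1).hom
          (Complex.I * (Real.sqrt d : ℂ)) ⊓
        hodgeOneZero (Motives.isSmoothProjective_of_dim_eq' hX)) = 2) :
    weilClassesOf (S.prod X)
        (AbelianVariety.prodLift (AbelianVariety.fst S X ≫ ψ) (AbelianVariety.snd S X ≫ φ)) (1 + 2) d ≤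
      algebraicClasses (S.prod X).X (1 + 2) :=
  weilClassesOf_prod_le_algebraicClasses one_pos hd hS hX hψ hφ
    (weilClassesOf_le_algebraicClasses_surface hS hd hψ hSbal)
    (weilClassesOf_fourfold_le_of_weilAlgebraicAll hd W hX hφ hXbal)

/-- **Fourfold × surface SIXFOLDS** (the other order of the factors), granted `WeilAlgebraicAll 2 d`.
[cite: Schoen1998HodgeWeilAddendum, §10] [cite: vanGeemen1994HodgeAV, 4.9] -/
theorem weilClassesOf_fourfold_prod_surface_le_of_weilAlgebraicAll {d : ℕ} (hd : 0 < d) (W : WeilAlgebraicAll 2 d)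
    (hX : X.dim = 2 * 2) (hS : S.dim = 2 * 1) {φ : X ⟶ X} {ψ : S ⟶ S}
    (hφ : φ ≫ φ = -(d • 𝟙 X)) (hψ : ψ ≫ ψ = -(d • 𝟙 S))
    (hXbal : Module.finrank ℂ ↥(Module.End.eigenspace (complexBetti.map φ.hom.hom.hom 1).hom
          (Complex.I * (Real.sqrt d : ℂ)) ⊓
        hodgeOneZero (Motives.isSmoothProjective_of_dim_eq' hX)) = 2)
    (hSbal : Module.finrank ℂ ↥(Module.End.eigenspace (complexBetti.map ψ.hom.hom.hom 1).hom
          (Complex.I * (Real.sqrt d : ℂ)) ⊓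
        hodgeOneZero (Motives.isSmoothProjective_of_dim_eq' hS)) = 1) :
    weilClassesOf (X.prod S)
        (AbelianVariety.prodLift (AbelianVariety.fst X S ≫ φ) (AbelianVariety.snd X S ≫ ψ)) (2 + 1) d ≤
      algebraicClasses (X.prod S).X (2 + 1) :=
  weilClassesOf_prod_le_algebraicClasses two_pos hd hX hS hφ hψ
    (weilClassesOf_fourfold_le_of_weilAlgebraicAll hd W hX hφ hXbal)
    (weilClassesOf_le_algebraicClasses_surface hS hd hψ hSbal)

/-- **Fourfold × fourfold EIGHTFOLDS, any discriminants, granted `WeilAlgebraicAll 2 d`.** For `d ≥ 1` and two balanced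
`(2,2)` fourfolds `(X, φ)`, `(Y, χ)` with `φ² = χ² = -d`: the Weil plane of `X × Y` (diagonal `K`, degree `8`) consists of
algebraic classes. [cite: Schoen1998HodgeWeilAddendum, §10] [cite: vanGeemen1994HodgeAV, 4.9] -/
theorem weilClassesOf_fourfold_prod_fourfold_le_of_weilAlgebraicAll {d : ℕ} (hd : 0 < d) (W : WeilAlgebraicAll 2 d)
    (hX : X.dim = 2 * 2) (hY : Y.dim = 2 * 2) {φ : X ⟶ X} {χ : Y ⟶ Y}
    (hφ : φ ≫ φ = -(d • 𝟙 X)) (hχ : χ ≫ χ = -(d • 𝟙 Y))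
    (hXbal : Module.finrank ℂ ↥(Module.End.eigenspace (complexBetti.map φ.hom.hom.hom 1).hom
          (Complex.I * (Real.sqrt d : ℂ)) ⊓
        hodgeOneZero (Motives.isSmoothProjective_of_dim_eq' hX)) = 2)
    (hYbal : Module.finrank ℂ ↥(Module.End.eigenspace (complexBetti.map χ.hom.hom.hom 1).hom
          (Complex.I * (Real.sqrt d : ℂ)) ⊓
        hodgeOneZero (Motives.isSmoothProjective_of_dim_eq' hY)) = 2) :
    weilClassesOf (X.prod Y)
        (AbelianVariety.prodLift (AbelianVariety.fst X Y ≫ φ) (AbelianVariety.snd X Y ≫ χ)) (2 + 2) d ≤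
      algebraicClasses (X.prod Y).X (2 + 2) :=
  weilClassesOf_prod_le_algebraicClasses two_pos hd hX hY hφ hχ
    (weilClassesOf_fourfold_le_of_weilAlgebraicAll hd W hX hφ hXbal)
    (weilClassesOf_fourfold_le_of_weilAlgebraicAll hd W hY hχ hYbal)

/-! ## §2 The refereed instances: `K = ℚ(√-3)` (Schoen 1998) and `K = ℚ(i)` (Koike 2004) -/

/-- **`K = ℚ(√-3)`: surface × fourfold sixfolds of ARBITRARY discriminants have algebraic Weil classes, granted Schoen's
refereed split-sixfold theorem ALONE** (every `ℚ(√-3)` Weil fourfold has algebraic Weil classes: Schoen 1998 Theorem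
p. 329, kernel-derived as `weilAlgebraicAll_two_of_floorSlice`). These are the `(2;1,1) × (4;2,2)` cusp fibres of the 16
open `(3,3)` census families (CENSUS-PRINT-G8 §5–§7).
[cite: Schoen1998HodgeWeilAddendum, Theorem (p. 329) and §10] [cite: vanGeemen1994HodgeAV, 4.9 and Thm. 6.12] -/
theorem weilClassesOf_surface_prod_fourfold_le_of_schoen1998
    (hS3 : Schoen1998_weilClasses_algebraic_hyperbolicSixfold_three)
    (hS : S.dim = 2 * 1) (hX : X.dim = 2 * 2) {ψ : S ⟶ S} {φ : X ⟶ X}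
    (hψ : ψ ≫ ψ = -((3 : ℕ) • 𝟙 S)) (hφ : φ ≫ φ = -((3 : ℕ) • 𝟙 X))
    (hSbal : Module.finrank ℂ ↥(Module.End.eigenspace (complexBetti.map ψ.hom.hom.hom 1).hom
          (Complex.I * (Real.sqrt (3 : ℕ) : ℂ)) ⊓
        hodgeOneZero (Motives.isSmoothProjective_of_dim_eq' hS)) = 1)
    (hXbal : Module.finrank ℂ ↥(Module.End.eigenspace (complexBetti.map φ.hom.hom.hom 1).hom
          (Complex.I * (Real.sqrt (3 : ℕ) : ℂ)) ⊓
        hodgeOneZero (Motives.isSmoothProjective_of_dim_eq' hX)) = 2) :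
    weilClassesOf (S.prod X)
        (AbelianVariety.prodLift (AbelianVariety.fst S X ≫ ψ) (AbelianVariety.snd S X ≫ φ)) (1 + 2) 3 ≤
      algebraicClasses (S.prod X).X (1 + 2) :=
  weilClassesOf_surface_prod_fourfold_le_of_weilAlgebraicAll (by norm_num)
    (weilAlgebraicAll_two_of_floorSlice (by norm_num) hS3) hS hX hψ hφ hSbal hXbal

/-- **`K = ℚ(√-3)`: fourfold × fourfold EIGHTFOLDS of ARBITRARY discriminants have algebraic Weil classes, granted
Schoen's refereed split-sixfold theorem ALONE.** These are the `(4;2,2) × (4;2,2)` cusp fibres of the 28 open `(4,4)`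
census families of `ℚ(√-3)`. [cite: Schoen1998HodgeWeilAddendum, Theorem (p. 329) and §10]
[cite: vanGeemen1994HodgeAV, 4.9 and Thm. 6.12] -/
theorem weilClassesOf_fourfold_prod_fourfold_le_of_schoen1998
    (hS3 : Schoen1998_weilClasses_algebraic_hyperbolicSixfold_three)
    (hX : X.dim = 2 * 2) (hY : Y.dim = 2 * 2) {φ : X ⟶ X} {χ : Y ⟶ Y}
    (hφ : φ ≫ φ = -((3 : ℕ) • 𝟙 X)) (hχ : χ ≫ χ = -((3 : ℕ) • 𝟙 Y))
    (hXbal : Module.finrank ℂ ↥(Module.End.eigenspace (complexBetti.map φ.hom.hom.hom 1).hom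
          (Complex.I * (Real.sqrt (3 : ℕ) : ℂ)) ⊓
        hodgeOneZero (Motives.isSmoothProjective_of_dim_eq' hX)) = 2)
    (hYbal : Module.finrank ℂ ↥(Module.End.eigenspace (complexBetti.map χ.hom.hom.hom 1).hom
          (Complex.I * (Real.sqrt (3 : ℕ) : ℂ)) ⊓
        hodgeOneZero (Motives.isSmoothProjective_of_dim_eq' hY)) = 2) :
    weilClassesOf (X.prod Y)
        (AbelianVariety.prodLift (AbelianVariety.fst X Y ≫ φ) (AbelianVariety.snd X Y ≫ χ)) (2 + 2) 3 ≤
      algebraicClasses (X.prod Y).X (2 + 2) :=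
  weilClassesOf_fourfold_prod_fourfold_le_of_weilAlgebraicAll (by norm_num)
    (weilAlgebraicAll_two_of_floorSlice (by norm_num) hS3) hX hY hφ hχ hXbal hYbal

/-- **`K = ℚ(i)`: surface × fourfold sixfolds of ARBITRARY discriminants, granted Koike's refereed split-sixfold
theorem ALONE** (Koike 2004 Rem. 2.1: every `ℚ(i)` Weil fourfold). [cite: Koike2004WeilHodge, Cor. 2.1 and Remark 2.1]
[cite: Schoen1998HodgeWeilAddendum, §10] -/
theorem weilClassesOf_surface_prod_fourfold_le_of_koike2004
    (hK : Koike2004_weilClasses_algebraic_hyperbolicSixfold_one)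
    (hS : S.dim = 2 * 1) (hX : X.dim = 2 * 2) {ψ : S ⟶ S} {φ : X ⟶ X}
    (hψ : ψ ≫ ψ = -((1 : ℕ) • 𝟙 S)) (hφ : φ ≫ φ = -((1 : ℕ) • 𝟙 X))
    (hSbal : Module.finrank ℂ ↥(Module.End.eigenspace (complexBetti.map ψ.hom.hom.hom 1).hom
          (Complex.I * (Real.sqrt (1 : ℕ) : ℂ)) ⊓
        hodgeOneZero (Motives.isSmoothProjective_of_dim_eq' hS)) = 1)
    (hXbal : Module.finrank ℂ ↥(Module.End.eigenspace (complexBetti.map φ.hom.hom.hom 1).hom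
          (Complex.I * (Real.sqrt (1 : ℕ) : ℂ)) ⊓
        hodgeOneZero (Motives.isSmoothProjective_of_dim_eq' hX)) = 2) :
    weilClassesOf (S.prod X)
        (AbelianVariety.prodLift (AbelianVariety.fst S X ≫ ψ) (AbelianVariety.snd S X ≫ φ)) (1 + 2) 1 ≤
      algebraicClasses (S.prod X).X (1 + 2) :=
  weilClassesOf_surface_prod_fourfold_le_of_weilAlgebraicAll one_pos
    (weilAlgebraicAll_two_of_floorSlice one_pos hK) hS hX hψ hφ hSbal hXbal

/-- **`K = ℚ(i)`: fourfold × fourfold EIGHTFOLDS of ARBITRARY discriminants, granted Koike's refereed split-sixfold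
theorem ALONE.** These are the `(4;2,2) × (4;2,2)` cusp fibres of the 24 open `(4,4)` census families of `ℚ(i)` (all
split; the rigid `ℚ(i)` block `W₄` of gen 7's LEMMA Q needs no separate treatment here).
[cite: Koike2004WeilHodge, Cor. 2.1 and Remark 2.1] [cite: Schoen1998HodgeWeilAddendum, §10] -/
theorem weilClassesOf_fourfold_prod_fourfold_le_of_koike2004
    (hK : Koike2004_weilClasses_algebraic_hyperbolicSixfold_one)
    (hX : X.dim = 2 * 2) (hY : Y.dim = 2 * 2) {φ : X ⟶ X} {χ : Y ⟶ Y}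
    (hφ : φ ≫ φ = -((1 : ℕ) • 𝟙 X)) (hχ : χ ≫ χ = -((1 : ℕ) • 𝟙 Y))
    (hXbal : Module.finrank ℂ ↥(Module.End.eigenspace (complexBetti.map φ.hom.hom.hom 1).hom
          (Complex.I * (Real.sqrt (1 : ℕ) : ℂ)) ⊓
        hodgeOneZero (Motives.isSmoothProjective_of_dim_eq' hX)) = 2)
    (hYbal : Module.finrank ℂ ↥(Module.End.eigenspace (complexBetti.map χ.hom.hom.hom 1).hom
          (Complex.I * (Real.sqrt (1 : ℕ) : ℂ)) ⊓
        hodgeOneZero (Motives.isSmoothProjective_of_dim_eq' hY)) = 2) :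
    weilClassesOf (X.prod Y)
        (AbelianVariety.prodLift (AbelianVariety.fst X Y ≫ φ) (AbelianVariety.snd X Y ≫ χ)) (2 + 2) 1 ≤
      algebraicClasses (X.prod Y).X (2 + 2) :=
  weilClassesOf_fourfold_prod_fourfold_le_of_weilAlgebraicAll one_pos
    (weilAlgebraicAll_two_of_floorSlice one_pos hK) hX hY hφ hχ hXbal hYbal

/-! ## §3 The `K`-isogenous members (the cusp fibres themselves) -/

/-- **Sixfolds `K`-isogenous to `S × X`, granted `WeilAlgebraicAll 2 d`.** Let `(A, Φ)` be an abelian sixfold with an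
isogeny pair `f : A ⟶ S × X` (flat), `g : S × X ⟶ A`, `g ≫ Φ = (ψ × φ) ≫ g`, `f ≫ g = m • 𝟙 A` (`m ≥ 1`), towards a
`(1,1)` surface `(S, ψ)` times a balanced `(2,2)` fourfold `(X, φ)` (`ψ² = φ² = -d`). Then every rational `(3,3)` class of
the Weil plane of `(A, Φ)` is algebraic. [cite: Markman2025SurveySecant, §11.5 Step 1] [cite: vanGeemen1994HodgeAV, 3.6–3.7 and 4.9] -/
theorem weilClass_algebraic_of_isogeny_surface_prod_fourfold_of_weilAlgebraicAll {d : ℕ} (hd : 0 < d)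
    (W : WeilAlgebraicAll 2 d) (hS : S.dim = 2 * 1) (hX : X.dim = 2 * 2) {ψ : S ⟶ S} {φ : X ⟶ X}
    (hψ : ψ ≫ ψ = -(d • 𝟙 S)) (hφ : φ ≫ φ = -(d • 𝟙 X))
    (hSbal : Module.finrank ℂ ↥(Module.End.eigenspace (complexBetti.map ψ.hom.hom.hom 1).hom
          (Complex.I * (Real.sqrt d : ℂ)) ⊓
        hodgeOneZero (Motives.isSmoothProjective_of_dim_eq' hS)) = 1)
    (hXbal : Module.finrank ℂ ↥(Module.End.eigenspace (complexBetti.map φ.hom.hom.hom 1).hom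
          (Complex.I * (Real.sqrt d : ℂ)) ⊓
        hodgeOneZero (Motives.isSmoothProjective_of_dim_eq' hX)) = 2)
    {A : AbelianVariety ℂ} {Φ : A ⟶ A} (hA : A.dim = 2 * (1 + 2))
    (MB : HodgeModel (2 * (1 + 2)) (S.prod X).X) (f : A ⟶ S.prod X) (g : S.prod X ⟶ A)
    [AlgebraicGeometry.Flat f.hom.hom.hom.left]
    (hg : g ≫ Φ = AbelianVariety.prodLift (AbelianVariety.fst S X ≫ ψ) (AbelianVariety.snd S X ≫ φ) ≫ g)
    {m : ℕ} (hm : 0 < m) (hfg : f ≫ g = m • 𝟙 A)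
    {c : complexBetti A.X (2 * (1 + 2))} (hc : IsRationalClass c)
    (hcH : IsOfHodgeType (2 * (1 + 2)) A.X (2 * (1 + 2)) (1 + 2) (1 + 2) c)
    (hcW : c ∈ weilClassesOf A Φ (1 + 2) d) :
    c ∈ algebraicClasses A.X (1 + 2) :=
  mem_algebraicClasses_of_isogeny_prod one_pos hd hS hX hψ hφ
    (weilClassesOf_le_algebraicClasses_surface hS hd hψ hSbal)
    (weilClassesOf_fourfold_le_of_weilAlgebraicAll hd W hX hφ hXbal) hA MB f g hg hm hfg hc hcH hcW

/-- **Eightfolds `K`-isogenous to `X × Y`, granted `WeilAlgebraicAll 2 d`** (two balanced `(2,2)` fourfolds; isogeny pair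
as above): every rational `(4,4)` class of the Weil plane of `(A, Φ)` is algebraic.
[cite: Markman2025SurveySecant, §11.5 Step 1] [cite: vanGeemen1994HodgeAV, 3.6–3.7 and 4.9] -/
theorem weilClass_algebraic_of_isogeny_fourfold_prod_fourfold_of_weilAlgebraicAll {d : ℕ} (hd : 0 < d)
    (W : WeilAlgebraicAll 2 d) (hX : X.dim = 2 * 2) (hY : Y.dim = 2 * 2) {φ : X ⟶ X} {χ : Y ⟶ Y}
    (hφ : φ ≫ φ = -(d • 𝟙 X)) (hχ : χ ≫ χ = -(d • 𝟙 Y))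
    (hXbal : Module.finrank ℂ ↥(Module.End.eigenspace (complexBetti.map φ.hom.hom.hom 1).hom
          (Complex.I * (Real.sqrt d : ℂ)) ⊓
        hodgeOneZero (Motives.isSmoothProjective_of_dim_eq' hX)) = 2)
    (hYbal : Module.finrank ℂ ↥(Module.End.eigenspace (complexBetti.map χ.hom.hom.hom 1).hom
          (Complex.I * (Real.sqrt d : ℂ)) ⊓
        hodgeOneZero (Motives.isSmoothProjective_of_dim_eq' hY)) = 2)
    {A : AbelianVariety ℂ} {Φ : A ⟶ A} (hA : A.dim = 2 * (2 + 2))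
    (MB : HodgeModel (2 * (2 + 2)) (X.prod Y).X) (f : A ⟶ X.prod Y) (g : X.prod Y ⟶ A)
    [AlgebraicGeometry.Flat f.hom.hom.hom.left]
    (hg : g ≫ Φ = AbelianVariety.prodLift (AbelianVariety.fst X Y ≫ φ) (AbelianVariety.snd X Y ≫ χ) ≫ g)
    {m : ℕ} (hm : 0 < m) (hfg : f ≫ g = m • 𝟙 A)
    {c : complexBetti A.X (2 * (2 + 2))} (hc : IsRationalClass c)
    (hcH : IsOfHodgeType (2 * (2 + 2)) A.X (2 * (2 + 2)) (2 + 2) (2 + 2) c)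
    (hcW : c ∈ weilClassesOf A Φ (2 + 2) d) :
    c ∈ algebraicClasses A.X (2 + 2) :=
  mem_algebraicClasses_of_isogeny_prod two_pos hd hX hY hφ hχ
    (weilClassesOf_fourfold_le_of_weilAlgebraicAll hd W hX hφ hXbal)
    (weilClassesOf_fourfold_le_of_weilAlgebraicAll hd W hY hχ hYbal) hA MB f g hg hm hfg hc hcH hcW

/-- **`K = ℚ(√-3)`, the cusp fibres of the 16 open `(3,3)` rows: sixfolds `K`-isogenous to `S × X` have algebraic
rational `(3,3)` Weil classes, granted Schoen 1998 ALONE** (refereed).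
[cite: Schoen1998HodgeWeilAddendum, Theorem (p. 329) and §10] [cite: vanGeemen1994HodgeAV, 3.6–3.7, 4.9, Thm. 6.12] -/
theorem weilClass_algebraic_of_isogeny_surface_prod_fourfold_of_schoen1998
    (hS3 : Schoen1998_weilClasses_algebraic_hyperbolicSixfold_three)
    (hS : S.dim = 2 * 1) (hX : X.dim = 2 * 2) {ψ : S ⟶ S} {φ : X ⟶ X}
    (hψ : ψ ≫ ψ = -((3 : ℕ) • 𝟙 S)) (hφ : φ ≫ φ = -((3 : ℕ) • 𝟙 X))
    (hSbal : Module.finrank ℂ ↥(Module.End.eigenspace (complexBetti.map ψ.hom.hom.hom 1).hom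
          (Complex.I * (Real.sqrt (3 : ℕ) : ℂ)) ⊓
        hodgeOneZero (Motives.isSmoothProjective_of_dim_eq' hS)) = 1)
    (hXbal : Module.finrank ℂ ↥(Module.End.eigenspace (complexBetti.map φ.hom.hom.hom 1).hom
          (Complex.I * (Real.sqrt (3 : ℕ) : ℂ)) ⊓
        hodgeOneZero (Motives.isSmoothProjective_of_dim_eq' hX)) = 2)
    {A : AbelianVariety ℂ} {Φ : A ⟶ A} (hA : A.dim = 2 * (1 + 2))
    (MB : HodgeModel (2 * (1 + 2)) (S.prod X).X) (f : A ⟶ S.prod X) (g : S.prod X ⟶ A)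
    [AlgebraicGeometry.Flat f.hom.hom.hom.left]
    (hg : g ≫ Φ = AbelianVariety.prodLift (AbelianVariety.fst S X ≫ ψ) (AbelianVariety.snd S X ≫ φ) ≫ g)
    {m : ℕ} (hm : 0 < m) (hfg : f ≫ g = m • 𝟙 A)
    {c : complexBetti A.X (2 * (1 + 2))} (hc : IsRationalClass c)
    (hcH : IsOfHodgeType (2 * (1 + 2)) A.X (2 * (1 + 2)) (1 + 2) (1 + 2) c)
    (hcW : c ∈ weilClassesOf A Φ (1 + 2) 3) :
    c ∈ algebraicClasses A.X (1 + 2) :=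
  weilClass_algebraic_of_isogeny_surface_prod_fourfold_of_weilAlgebraicAll (by norm_num)
    (weilAlgebraicAll_two_of_floorSlice (by norm_num) hS3) hS hX hψ hφ hSbal hXbal hA MB f g hg hm hfg hc hcH hcW

/-- **`K = ℚ(√-3)`, the cusp fibres of the 28 open `(4,4)` rows of `ℚ(√-3)`: eightfolds `K`-isogenous to `X × Y` have
algebraic rational `(4,4)` Weil classes, granted Schoen 1998 ALONE** (refereed).
[cite: Schoen1998HodgeWeilAddendum, Theorem (p. 329) and §10] [cite: vanGeemen1994HodgeAV, 3.6–3.7, 4.9, Thm. 6.12] -/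
theorem weilClass_algebraic_of_isogeny_fourfold_prod_fourfold_of_schoen1998
    (hS3 : Schoen1998_weilClasses_algebraic_hyperbolicSixfold_three)
    (hX : X.dim = 2 * 2) (hY : Y.dim = 2 * 2) {φ : X ⟶ X} {χ : Y ⟶ Y}
    (hφ : φ ≫ φ = -((3 : ℕ) • 𝟙 X)) (hχ : χ ≫ χ = -((3 : ℕ) • 𝟙 Y))
    (hXbal : Module.finrank ℂ ↥(Module.End.eigenspace (complexBetti.map φ.hom.hom.hom 1).hom
          (Complex.I * (Real.sqrt (3 : ℕ) : ℂ)) ⊓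
        hodgeOneZero (Motives.isSmoothProjective_of_dim_eq' hX)) = 2)
    (hYbal : Module.finrank ℂ ↥(Module.End.eigenspace (complexBetti.map χ.hom.hom.hom 1).hom
          (Complex.I * (Real.sqrt (3 : ℕ) : ℂ)) ⊓
        hodgeOneZero (Motives.isSmoothProjective_of_dim_eq' hY)) = 2)
    {A : AbelianVariety ℂ} {Φ : A ⟶ A} (hA : A.dim = 2 * (2 + 2))
    (MB : HodgeModel (2 * (2 + 2)) (X.prod Y).X) (f : A ⟶ X.prod Y) (g : X.prod Y ⟶ A)
    [AlgebraicGeometry.Flat f.hom.hom.hom.left]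
    (hg : g ≫ Φ = AbelianVariety.prodLift (AbelianVariety.fst X Y ≫ φ) (AbelianVariety.snd X Y ≫ χ) ≫ g)
    {m : ℕ} (hm : 0 < m) (hfg : f ≫ g = m • 𝟙 A)
    {c : complexBetti A.X (2 * (2 + 2))} (hc : IsRationalClass c)
    (hcH : IsOfHodgeType (2 * (2 + 2)) A.X (2 * (2 + 2)) (2 + 2) (2 + 2) c)
    (hcW : c ∈ weilClassesOf A Φ (2 + 2) 3) :
    c ∈ algebraicClasses A.X (2 + 2) :=
  weilClass_algebraic_of_isogeny_fourfold_prod_fourfold_of_weilAlgebraicAll (by norm_num)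
    (weilAlgebraicAll_two_of_floorSlice (by norm_num) hS3) hX hY hφ hχ hXbal hYbal hA MB f g hg hm hfg hc hcH hcW

/-- **`K = ℚ(i)`, the cusp fibres of the 24 open `(4,4)` rows of `ℚ(i)`: eightfolds `K`-isogenous to `X × Y` have
algebraic rational `(4,4)` Weil classes, granted Koike 2004 ALONE** (refereed).
[cite: Koike2004WeilHodge, Cor. 2.1 and Remark 2.1] [cite: Schoen1998HodgeWeilAddendum, §10] -/
theorem weilClass_algebraic_of_isogeny_fourfold_prod_fourfold_of_koike2004
    (hK : Koike2004_weilClasses_algebraic_hyperbolicSixfold_one)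
    (hX : X.dim = 2 * 2) (hY : Y.dim = 2 * 2) {φ : X ⟶ X} {χ : Y ⟶ Y}
    (hφ : φ ≫ φ = -((1 : ℕ) • 𝟙 X)) (hχ : χ ≫ χ = -((1 : ℕ) • 𝟙 Y))
    (hXbal : Module.finrank ℂ ↥(Module.End.eigenspace (complexBetti.map φ.hom.hom.hom 1).hom
          (Complex.I * (Real.sqrt (1 : ℕ) : ℂ)) ⊓
        hodgeOneZero (Motives.isSmoothProjective_of_dim_eq' hX)) = 2)
    (hYbal : Module.finrank ℂ ↥(Module.End.eigenspace (complexBetti.map χ.hom.hom.hom 1).hom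
          (Complex.I * (Real.sqrt (1 : ℕ) : ℂ)) ⊓
        hodgeOneZero (Motives.isSmoothProjective_of_dim_eq' hY)) = 2)
    {A : AbelianVariety ℂ} {Φ : A ⟶ A} (hA : A.dim = 2 * (2 + 2))
    (MB : HodgeModel (2 * (2 + 2)) (X.prod Y).X) (f : A ⟶ X.prod Y) (g : X.prod Y ⟶ A)
    [AlgebraicGeometry.Flat f.hom.hom.hom.left]
    (hg : g ≫ Φ = AbelianVariety.prodLift (AbelianVariety.fst X Y ≫ φ) (AbelianVariety.snd X Y ≫ χ) ≫ g)
    {m : ℕ} (hm : 0 < m) (hfg : f ≫ g = m • 𝟙 A)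
    {c : complexBetti A.X (2 * (2 + 2))} (hc : IsRationalClass c)
    (hcH : IsOfHodgeType (2 * (2 + 2)) A.X (2 * (2 + 2)) (2 + 2) (2 + 2) c)
    (hcW : c ∈ weilClassesOf A Φ (2 + 2) 1) :
    c ∈ algebraicClasses A.X (2 + 2) :=
  weilClass_algebraic_of_isogeny_fourfold_prod_fourfold_of_weilAlgebraicAll one_pos
    (weilAlgebraicAll_two_of_floorSlice one_pos hK) hX hY hφ hχ hXbal hYbal hA MB f g hg hm hfg hc hcH hcW

end Summit.HodgeConjecture.HodgeConjecture.Ring2.AbelianAll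

end
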